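import Summits.QuantumFields.YangMills.Theorems.UnitScaleTiltProp7PinnedRegaugeChartDivergenceHR
import HarnessLib

/-!
# Prop 7 pinned re-gauge chart — the row `hRK` of the (α′) knit, M-BOOKED (namer note (a), ★p1 g14 19:14:09Z)

Route-R E′, path (α′), gap (P-bch-div) of `stmt-QuantumFields-19200` (crux `MinimiserStabilityRegPr`), cell ym3-torus, width seat px15.

WHY.  ✓ `Prop7PinnedRegaugeChartDivergenceHR.plaqK_le_of_sup` books the door's linearised-curvature energy `K_W(i·R)` of the chart remainder against a
sup row — a VOLUME bound, which cannot inhabit `ζ₃K_W(D) + θ₃ℓ⁻²Σ‖D‖²` for small competitors.  The right row is BILINEAR and ℓ²: pointwise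
`‖R_b‖ ≤ (4σ + 8ρ)‖Y_b‖ + 6σ‖δ_b‖` (the three-piece split of ✓ `Prop7PinnedRegaugeChartDiagonal.chartRemainderDiag_split` with each piece bounded by
the bond's OWN letters `Y_b`, `δ_b`), `K_W(i·R) ≤ 16d·Σ_b‖R_b‖²` (each plaquette term is a signed sum of four conjugates; each bond lies in at most `4d`
plaquette slots), hence `K_W(i·R) ≤ 16d·[2(4σ+8ρ)²·Σ_b‖Y_b‖² + 72σ²·Σ_b‖δ_b‖²]` — `θ₃ ∝ (σ + ρ)²` times bond masses, as the knit wants.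

WHAT IS PROVED (def-free; any `P`, level `i`, `SU(N)`).
* §1 ★ `norm_chartRemainderDiag_le_bilinear` — `‖Φ♯(u, E, δ)‖ ≤ (4σ + 8ρ)·‖E − 1‖ + 6σ·‖δ‖` (`‖u − 1‖ ≤ σ`, `‖E − 1‖ ≤ τ`, `‖δ‖ ≤ ρ`, all `≤ 1∕256`).
* §2 `sum_plaq_le_sum_site_dir` (a non-negative plaquette sum is at most the site × direction × direction sum), ★ `plaqK_le_sum_bond`
  (`K_W(i·R) ≤ 16d·Σ_b‖R_b‖²`, any `W`, any `R`).
* §3 ★ `sum_norm_sq_chartRemainder_le` (`Σ_b‖R_b‖² ≤ 2(4σ+8ρ)²Σ_b‖Y_b‖² + 72σ²Σ_b‖δ_b‖²` when `i·R = Φ♯(u, Y+1, δ)`), ★★★ `plaqK_le_of_bilinear` (the row `hRK`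
  of ✓ `Prop7SliceOfCorrectorRows.slice_of_corrector_rows`, M-booked: `K_W(i·R) ≤ 16d·(2(4σ+8ρ)²Σ_b‖Y_b‖² + 72σ²Σ_b‖δ_b‖²)`).
HONEST SCOPE.  Bookkeeping over the landed bricks; the `M_Y, M_δ ↔ Σ‖D‖²` conversion and the `Y ↔ D‴` junction (S4′) are separate.  Constants ours.

References: T. Bałaban, CMP 102 (1985) 277–309 [Balaban1985Variational] ((47)–(48) pp.285–286, (141)–(143) p.299); CMP 98 (1985) 17–51 [Balaban1985Averaging]
((31) p.22, (9) p.19).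
-/

set_option autoImplicit false

noncomputable section

open scoped BigOperators Matrix.Norms.L2Operator Matrix
open NormedSpace

namespace Summit.QuantumFields.YangMills.Theorems.Prop7PinnedRegaugeChartDivergenceHRK

open Literature.MathematicalPhysics.QuantumFieldTheory.Balaban1983to89
open Finset B1RG242Torus
open MatrixLog (mlog norm_mlog_le_two_mul)
open B7Eq31BCH (eq31_of_sum_le)
open B10StarCount (sum_pbond)
open B9TorusCalculus (torusT torusT_apply)
open Summit.QuantumFields.YangMills.Theorems.Prop7HolRatioPerStep (norm_star_coe_eq_one)
open Summit.QuantumFields.YangMills.Theorems.Prop7CovIterLambdaBound (norm_conj_su_le)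
open Summit.QuantumFields.YangMills.Theorems.Prop7PinnedRegaugeChartBCH (norm_mlog_mul_exp_neg_mlog_add_sub_le)
open Summit.QuantumFields.YangMills.Theorems.Prop7PinnedRegaugeChartLipschitz (norm_mul_le_left_of_le_one)
open Summit.QuantumFields.YangMills.Theorems.Prop7PinnedRegaugeChartDiagonal (diag_pack chartRemainderDiag_split)

/-! ## §1 The bilinear pointwise row of the chart remainder -/

section Bilinear

variable {n : Type*} [Fintype n] [DecidableEq n] [Nonempty n]

/-- ★ **THE CHART REMAINDER IS BILINEAR IN THE BOND'S OWN LETTERS.**  For `‖u − 1‖ ≤ σ`, `‖E − 1‖ ≤ τ`, `‖δ‖ ≤ ρ` (`σ, τ, ρ ≤ 1∕256`):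
`‖Φ♯(u, E, δ)‖ ≤ (4σ + 8ρ)·‖E − 1‖ + 6σ·‖δ‖` (three-piece split: `‖r(A, L)‖ ≤ 2‖A‖‖L‖ ≤ 2·2‖E−1‖·2ρ`; Leibniz piece `≤ 2σ‖log E‖ ≤ 4σ‖E−1‖`;
`‖Ψ(u, δ)‖ ≤ 3‖log u‖‖δ‖ ≤ 6σ‖δ‖`). [cite: Balaban1985Averaging, (31) p.22] [cite: Balaban1985Variational, (141)-(143) p.299] -/
theorem norm_chartRemainderDiag_le_bilinear (u : Matrix.specialUnitaryGroup n ℂ) (E δ : Matrix n n ℂ) {σ τ ρ : ℝ}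
    (hσ : σ ≤ 1 / 256) (hτ : τ ≤ 1 / 256) (hρ : ρ ≤ 1 / 256)
    (hu : ‖(u : Matrix n n ℂ) - 1‖ ≤ σ) (hE : ‖E - 1‖ ≤ τ) (hδ : ‖δ‖ ≤ ρ) :
    ‖mlog ((u : Matrix n n ℂ) * E * exp (-mlog (u : Matrix n n ℂ) + δ)) - (mlog E + δ)‖ ≤ (4 * σ + 8 * ρ) * ‖E - 1‖ + 6 * σ * ‖δ‖ := by
  have hσ0 : 0 ≤ σ := (norm_nonneg _).trans hu
  have hρ0 : 0 ≤ ρ := (norm_nonneg _).trans hδ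
  have hE1 : ‖E - 1‖ < 1 := by linarith
  have hE0 : 0 ≤ ‖E - 1‖ := norm_nonneg _
  have hlogE : ‖mlog E‖ ≤ 2 * ‖E - 1‖ := norm_mlog_le_two_mul (hE.trans (by linarith))
  have hlogE' : ‖mlog E‖ ≤ 2 * τ := hlogE.trans (by linarith)
  obtain ⟨hX, hL, -⟩ := diag_pack u δ hσ hρ hu hδ
  rw [chartRemainderDiag_split u E δ hσ hρ hu hE1 hδ]
  -- piece 1
  have hA : ‖(u : Matrix n n ℂ) * mlog E * star (u : Matrix n n ℂ)‖ ≤ 2 * ‖E - 1‖ := (norm_conj_su_le u _).trans hlogE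
  have t1 : ‖mlog (exp ((u : Matrix n n ℂ) * mlog E * star (u : Matrix n n ℂ)) * exp (mlog ((u : Matrix n n ℂ) * exp (-mlog (u : Matrix n n ℂ) + δ))))
        - (u : Matrix n n ℂ) * mlog E * star (u : Matrix n n ℂ) - mlog ((u : Matrix n n ℂ) * exp (-mlog (u : Matrix n n ℂ) + δ))‖ ≤ 8 * ρ * ‖E - 1‖ := by
    have h := eq31_of_sum_le (X := (u : Matrix n n ℂ) * mlog E * star (u : Matrix n n ℂ))
      (Y := mlog ((u : Matrix n n ℂ) * exp (-mlog (u : Matrix n n ℂ) + δ))) (by linarith)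
    have h2 : 2 * ‖(u : Matrix n n ℂ) * mlog E * star (u : Matrix n n ℂ)‖ * ‖mlog ((u : Matrix n n ℂ) * exp (-mlog (u : Matrix n n ℂ) + δ))‖
        ≤ 2 * (2 * ‖E - 1‖) * (2 * ρ) := mul_le_mul (by linarith) hL (norm_nonneg _) (by positivity)
    linarith
  -- piece 2
  have t2 : ‖((u : Matrix n n ℂ) - 1) * mlog E * star (u : Matrix n n ℂ) + mlog E * (star (u : Matrix n n ℂ) - 1)‖ ≤ 4 * σ * ‖E - 1‖ := by
    have hs : ‖star (u : Matrix n n ℂ) - 1‖ ≤ σ := by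
      rw [← star_one, ← star_sub, norm_star]; exact hu
    have a1 : ‖((u : Matrix n n ℂ) - 1) * mlog E * star (u : Matrix n n ℂ)‖ ≤ σ * (2 * ‖E - 1‖) :=
      (norm_mul_le_left_of_le_one (norm_star_coe_eq_one u).le).trans ((norm_mul_le _ _).trans (mul_le_mul hu hlogE (norm_nonneg _) hσ0))
    have a2 : ‖mlog E * (star (u : Matrix n n ℂ) - 1)‖ ≤ 2 * ‖E - 1‖ * σ :=
      (norm_mul_le _ _).trans (mul_le_mul hlogE hs (norm_nonneg _) (by positivity))
    have := norm_add_le (((u : Matrix n n ℂ) - 1) * mlog E * star (u : Matrix n n ℂ)) (mlog E * (star (u : Matrix n n ℂ) - 1))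
    nlinarith
  -- piece 3
  have t3 : ‖mlog ((u : Matrix n n ℂ) * exp (-mlog (u : Matrix n n ℂ) + δ)) - δ‖ ≤ 6 * σ * ‖δ‖ := by
    have h := norm_mlog_mul_exp_neg_mlog_add_sub_le u δ (hu.trans (by linarith)) (hδ.trans (by linarith))
    have h2 : 3 * ‖mlog (u : Matrix n n ℂ)‖ * ‖δ‖ ≤ 3 * (2 * σ) * ‖δ‖ := mul_le_mul_of_nonneg_right (by linarith) (norm_nonneg _)
    linarith
  have h := norm_add₃_le
    (a := mlog (exp ((u : Matrix n n ℂ) * mlog E * star (u : Matrix n n ℂ)) * exp (mlog ((u : Matrix n n ℂ) * exp (-mlog (u : Matrix n n ℂ) + δ))))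
        - (u : Matrix n n ℂ) * mlog E * star (u : Matrix n n ℂ) - mlog ((u : Matrix n n ℂ) * exp (-mlog (u : Matrix n n ℂ) + δ)))
    (b := ((u : Matrix n n ℂ) - 1) * mlog E * star (u : Matrix n n ℂ) + mlog E * (star (u : Matrix n n ℂ) - 1))
    (c := mlog ((u : Matrix n n ℂ) * exp (-mlog (u : Matrix n n ℂ) + δ)) - δ)
  nlinarith

end Bilinear

/-! ## §2 The plaquette energy against the bond mass -/

section Plaquette

variable {P : Params} {N : ℕ} [NeZero N] {i : ℕ}

omit [NeZero N] in
/-- A non-negative plaquette functional summed over the plaquettes is at most its sum over ALL (site, direction, direction) triples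
(the plaquettes inject into the triples). [folklore] [cite: Balaban1985Averaging, (5) p.18] -/
theorem sum_plaq_le_sum_site_dir (g : Site P i → Fin P.d → Fin P.d → ℝ) (hg : ∀ x μ ν, 0 ≤ g x μ ν) :
    ∑ p : Plaq P i, g p.src p.μ p.ν ≤ ∑ x : Site P i, ∑ μ : Fin P.d, ∑ ν : Fin P.d, g x μ ν := by
  classical
  have hinj : Function.Injective (fun p : Plaq P i => (p.src, p.μ, p.ν)) := by
    rintro ⟨x, μ, ν, h⟩ ⟨x', μ', ν', h'⟩ hpq
    simp only [Prod.mk.injEq] at hpq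
    obtain ⟨h1, h2, h3⟩ := hpq
    subst h1; subst h2; subst h3
    rfl
  calc ∑ p : Plaq P i, g p.src p.μ p.ν
      = ∑ t ∈ (Finset.univ : Finset (Plaq P i)).image (fun p => (p.src, p.μ, p.ν)), g t.1 t.2.1 t.2.2 := by
        rw [Finset.sum_image fun p _ q _ h => hinj h]
    _ ≤ ∑ t : Site P i × Fin P.d × Fin P.d, g t.1 t.2.1 t.2.2 :=
        Finset.sum_le_sum_of_subset_of_nonneg (Finset.subset_univ _) (fun t _ _ => hg _ _ _)
    _ = ∑ x : Site P i, ∑ μ : Fin P.d, ∑ ν : Fin P.d, g x μ ν := by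
        rw [Fintype.sum_prod_type]
        exact Finset.sum_congr rfl fun x _ => by rw [Fintype.sum_prod_type]

omit [NeZero N] in
/-- The four bond slots of the plaquettes, each against the bond mass: `Σ_x Σ_μ Σ_ν ‖R(x + e_μ?, ·)‖² = d·Σ_b‖R_b‖²` shapes. [folklore] -/
theorem sum_site_dir_dir_shift_eq (R : PBond P i → Matrix (Fin N) (Fin N) ℂ) :
    (∑ x : Site P i, ∑ μ : Fin P.d, ∑ _ν : Fin P.d, ‖R ⟨x, μ⟩‖ ^ 2 = P.d * ∑ b : PBond P i, ‖R b‖ ^ 2) ∧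
    (∑ x : Site P i, ∑ μ : Fin P.d, ∑ ν : Fin P.d, ‖R ⟨x.shift μ, ν⟩‖ ^ 2 = P.d * ∑ b : PBond P i, ‖R b‖ ^ 2) ∧
    (∑ x : Site P i, ∑ μ : Fin P.d, ∑ ν : Fin P.d, ‖R ⟨x.shift ν, μ⟩‖ ^ 2 = P.d * ∑ b : PBond P i, ‖R b‖ ^ 2) ∧
    (∑ x : Site P i, ∑ _μ : Fin P.d, ∑ ν : Fin P.d, ‖R ⟨x, ν⟩‖ ^ 2 = P.d * ∑ b : PBond P i, ‖R b‖ ^ 2) := by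
  have hshift : ∀ (κ : Fin P.d) (f : Site P i → ℝ), ∑ x : Site P i, f (x.shift κ) = ∑ x : Site P i, f x := fun κ f => by
    have h := Equiv.sum_comp (torusT P i κ) f
    simpa only [torusT_apply] using h
  have hb : ∑ b : PBond P i, ‖R b‖ ^ 2 = ∑ x : Site P i, ∑ μ : Fin P.d, ‖R ⟨x, μ⟩‖ ^ 2 := sum_pbond _
  have hd : ∀ (c : ℝ), ∑ _ν : Fin P.d, c = P.d * c := fun c => by simp
  refine ⟨?_, ?_, ?_, ?_⟩
  · rw [hb, Finset.mul_sum]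
    refine Finset.sum_congr rfl fun x _ => ?_
    rw [Finset.mul_sum]
    exact Finset.sum_congr rfl fun μ _ => hd _
  · rw [Finset.sum_comm]
    rw [show ∑ μ : Fin P.d, ∑ x : Site P i, ∑ ν : Fin P.d, ‖R ⟨x.shift μ, ν⟩‖ ^ 2 = ∑ μ : Fin P.d, ∑ x : Site P i, ∑ ν : Fin P.d, ‖R ⟨x, ν⟩‖ ^ 2 from
      Finset.sum_congr rfl fun μ _ => hshift μ (fun y => ∑ ν : Fin P.d, ‖R ⟨y, ν⟩‖ ^ 2)]
    rw [hd, hb]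
  · calc ∑ x : Site P i, ∑ μ : Fin P.d, ∑ ν : Fin P.d, ‖R ⟨x.shift ν, μ⟩‖ ^ 2
        = ∑ μ : Fin P.d, ∑ ν : Fin P.d, ∑ x : Site P i, ‖R ⟨x.shift ν, μ⟩‖ ^ 2 := by
          rw [Finset.sum_comm]; exact Finset.sum_congr rfl fun μ _ => Finset.sum_comm
      _ = ∑ μ : Fin P.d, ∑ _ν : Fin P.d, ∑ x : Site P i, ‖R ⟨x, μ⟩‖ ^ 2 :=
          Finset.sum_congr rfl fun μ _ => Finset.sum_congr rfl fun ν _ => hshift ν (fun y => ‖R ⟨y, μ⟩‖ ^ 2)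
      _ = ∑ μ : Fin P.d, (P.d : ℝ) * ∑ x : Site P i, ‖R ⟨x, μ⟩‖ ^ 2 := Finset.sum_congr rfl fun μ _ => hd _
      _ = P.d * ∑ b : PBond P i, ‖R b‖ ^ 2 := by rw [← Finset.mul_sum, hb, Finset.sum_comm]
  · rw [hb, Finset.mul_sum]
    refine Finset.sum_congr rfl fun x _ => ?_
    rw [Finset.sum_comm, Finset.mul_sum]
    exact Finset.sum_congr rfl fun ν _ => hd _

/-- ★ **THE PLAQUETTE ENERGY AGAINST THE BOND MASS**: for any background `W` and any bond field `R`,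
`K_W(i·R) ≤ 16d·Σ_b‖R_b‖²` (each plaquette term is a signed sum of four `SU(N)`-conjugates of `i·R` at the four boundary bonds, `(Σ⁴)² ≤ 4Σ²`,
and each of the four bond slots sums to at most `d·Σ_b‖R_b‖²`). [cite: Balaban1985Variational, (47)-(48) pp.285-286] [cite: Balaban1985Averaging, (9) p.19] -/
theorem plaqK_le_sum_bond (W : GaugeField P i (Matrix.specialUnitaryGroup (Fin N) ℂ)) (R : PBond P i → Matrix (Fin N) (Fin N) ℂ) :
    (∑ p : Plaq P i, ‖((Complex.I • R ⟨p.src, p.μ⟩)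
          + ((W ⟨p.src, p.μ⟩ : Matrix (Fin N) (Fin N) ℂ) * (Complex.I • R ⟨p.src.shift p.μ, p.ν⟩) * star (W ⟨p.src, p.μ⟩ : Matrix (Fin N) (Fin N) ℂ))
          - (((W ⟨p.src, p.μ⟩ * W ⟨p.src.shift p.μ, p.ν⟩ * (W ⟨p.src.shift p.ν, p.μ⟩)⁻¹ : Matrix.specialUnitaryGroup (Fin N) ℂ) : Matrix (Fin N) (Fin N) ℂ)
              * (Complex.I • R ⟨p.src.shift p.ν, p.μ⟩)
              * star ((W ⟨p.src, p.μ⟩ * W ⟨p.src.shift p.μ, p.ν⟩ * (W ⟨p.src.shift p.ν, p.μ⟩)⁻¹ : Matrix.specialUnitaryGroup (Fin N) ℂ) : Matrix (Fin N) (Fin N) ℂ))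
          - (((GaugeField.plaqHol W p : Matrix.specialUnitaryGroup (Fin N) ℂ) : Matrix (Fin N) (Fin N) ℂ) * (Complex.I • R ⟨p.src, p.ν⟩)
              * star ((GaugeField.plaqHol W p : Matrix.specialUnitaryGroup (Fin N) ℂ) : Matrix (Fin N) (Fin N) ℂ)))‖ ^ 2)
      ≤ 16 * P.d * ∑ b : PBond P i, ‖R b‖ ^ 2 := by
  have hI : ∀ b, ‖Complex.I • R b‖ = ‖R b‖ := fun b => by rw [norm_smul, Complex.norm_I, one_mul]
  -- pointwise: `(n₁ + n₂ + n₃ + n₄)² ≤ 4(n₁² + n₂² + n₃² + n₄²)`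
  have hpt : ∀ p : Plaq P i, ‖((Complex.I • R ⟨p.src, p.μ⟩)
          + ((W ⟨p.src, p.μ⟩ : Matrix (Fin N) (Fin N) ℂ) * (Complex.I • R ⟨p.src.shift p.μ, p.ν⟩) * star (W ⟨p.src, p.μ⟩ : Matrix (Fin N) (Fin N) ℂ))
          - (((W ⟨p.src, p.μ⟩ * W ⟨p.src.shift p.μ, p.ν⟩ * (W ⟨p.src.shift p.ν, p.μ⟩)⁻¹ : Matrix.specialUnitaryGroup (Fin N) ℂ) : Matrix (Fin N) (Fin N) ℂ)
              * (Complex.I • R ⟨p.src.shift p.ν, p.μ⟩)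
              * star ((W ⟨p.src, p.μ⟩ * W ⟨p.src.shift p.μ, p.ν⟩ * (W ⟨p.src.shift p.ν, p.μ⟩)⁻¹ : Matrix.specialUnitaryGroup (Fin N) ℂ) : Matrix (Fin N) (Fin N) ℂ))
          - (((GaugeField.plaqHol W p : Matrix.specialUnitaryGroup (Fin N) ℂ) : Matrix (Fin N) (Fin N) ℂ) * (Complex.I • R ⟨p.src, p.ν⟩)
              * star ((GaugeField.plaqHol W p : Matrix.specialUnitaryGroup (Fin N) ℂ) : Matrix (Fin N) (Fin N) ℂ)))‖ ^ 2
        ≤ 4 * (‖R ⟨p.src, p.μ⟩‖ ^ 2 + ‖R ⟨p.src.shift p.μ, p.ν⟩‖ ^ 2 + ‖R ⟨p.src.shift p.ν, p.μ⟩‖ ^ 2 + ‖R ⟨p.src, p.ν⟩‖ ^ 2) := by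
    intro p
    have h1 : ‖Complex.I • R ⟨p.src, p.μ⟩‖ ≤ ‖R ⟨p.src, p.μ⟩‖ := (hI _).le
    have h2 : ‖(W ⟨p.src, p.μ⟩ : Matrix (Fin N) (Fin N) ℂ) * (Complex.I • R ⟨p.src.shift p.μ, p.ν⟩) * star (W ⟨p.src, p.μ⟩ : Matrix (Fin N) (Fin N) ℂ)‖
        ≤ ‖R ⟨p.src.shift p.μ, p.ν⟩‖ := (norm_conj_su_le _ _).trans (hI _).le
    have h3 : ‖(((W ⟨p.src, p.μ⟩ * W ⟨p.src.shift p.μ, p.ν⟩ * (W ⟨p.src.shift p.ν, p.μ⟩)⁻¹ : Matrix.specialUnitaryGroup (Fin N) ℂ) : Matrix (Fin N) (Fin N) ℂ)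
              * (Complex.I • R ⟨p.src.shift p.ν, p.μ⟩)
              * star ((W ⟨p.src, p.μ⟩ * W ⟨p.src.shift p.μ, p.ν⟩ * (W ⟨p.src.shift p.ν, p.μ⟩)⁻¹ : Matrix.specialUnitaryGroup (Fin N) ℂ) : Matrix (Fin N) (Fin N) ℂ))‖
        ≤ ‖R ⟨p.src.shift p.ν, p.μ⟩‖ := (norm_conj_su_le _ _).trans (hI _).le
    have h4 : ‖(((GaugeField.plaqHol W p : Matrix.specialUnitaryGroup (Fin N) ℂ) : Matrix (Fin N) (Fin N) ℂ) * (Complex.I • R ⟨p.src, p.ν⟩)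
              * star ((GaugeField.plaqHol W p : Matrix.specialUnitaryGroup (Fin N) ℂ) : Matrix (Fin N) (Fin N) ℂ))‖ ≤ ‖R ⟨p.src, p.ν⟩‖ :=
      (norm_conj_su_le _ _).trans (hI _).le
    have hs := (norm_sub_le _ _).trans (add_le_add ((norm_sub_le _ _).trans (add_le_add ((norm_add_le _ _).trans (add_le_add h1 h2)) h3)) h4)
    have h0 := norm_nonneg ((Complex.I • R ⟨p.src, p.μ⟩)
          + ((W ⟨p.src, p.μ⟩ : Matrix (Fin N) (Fin N) ℂ) * (Complex.I • R ⟨p.src.shift p.μ, p.ν⟩) * star (W ⟨p.src, p.μ⟩ : Matrix (Fin N) (Fin N) ℂ))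
          - (((W ⟨p.src, p.μ⟩ * W ⟨p.src.shift p.μ, p.ν⟩ * (W ⟨p.src.shift p.ν, p.μ⟩)⁻¹ : Matrix.specialUnitaryGroup (Fin N) ℂ) : Matrix (Fin N) (Fin N) ℂ)
              * (Complex.I • R ⟨p.src.shift p.ν, p.μ⟩)
              * star ((W ⟨p.src, p.μ⟩ * W ⟨p.src.shift p.μ, p.ν⟩ * (W ⟨p.src.shift p.ν, p.μ⟩)⁻¹ : Matrix.specialUnitaryGroup (Fin N) ℂ) : Matrix (Fin N) (Fin N) ℂ))
          - (((GaugeField.plaqHol W p : Matrix.specialUnitaryGroup (Fin N) ℂ) : Matrix (Fin N) (Fin N) ℂ) * (Complex.I • R ⟨p.src, p.ν⟩)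
              * star ((GaugeField.plaqHol W p : Matrix.specialUnitaryGroup (Fin N) ℂ) : Matrix (Fin N) (Fin N) ℂ)))
    have hsq := pow_le_pow_left₀ h0 hs 2
    nlinarith [sq_nonneg (‖R ⟨p.src, p.μ⟩‖ - ‖R ⟨p.src.shift p.μ, p.ν⟩‖), sq_nonneg (‖R ⟨p.src, p.μ⟩‖ - ‖R ⟨p.src.shift p.ν, p.μ⟩‖),
      sq_nonneg (‖R ⟨p.src, p.μ⟩‖ - ‖R ⟨p.src, p.ν⟩‖), sq_nonneg (‖R ⟨p.src.shift p.μ, p.ν⟩‖ - ‖R ⟨p.src.shift p.ν, p.μ⟩‖),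
      sq_nonneg (‖R ⟨p.src.shift p.μ, p.ν⟩‖ - ‖R ⟨p.src, p.ν⟩‖), sq_nonneg (‖R ⟨p.src.shift p.ν, p.μ⟩‖ - ‖R ⟨p.src, p.ν⟩‖)]
  -- sum over the plaquettes, then the four slots
  have hsum := Finset.sum_le_sum fun p (_ : p ∈ (Finset.univ : Finset (Plaq P i))) => hpt p
  refine hsum.trans ?_
  have hle := sum_plaq_le_sum_site_dir (P := P) (i := i)
    (fun x μ ν => 4 * (‖R ⟨x, μ⟩‖ ^ 2 + ‖R ⟨x.shift μ, ν⟩‖ ^ 2 + ‖R ⟨x.shift ν, μ⟩‖ ^ 2 + ‖R ⟨x, ν⟩‖ ^ 2)) (fun x μ ν => by positivity)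
  refine hle.trans (le_of_eq ?_)
  obtain ⟨e1, e2, e3, e4⟩ := sum_site_dir_dir_shift_eq (P := P) (i := i) R
  simp only [Finset.mul_sum, mul_add] at e1 e2 e3 e4 ⊢
  simp only [Finset.sum_add_distrib]
  simp only [← Finset.mul_sum] at e1 e2 e3 e4 ⊢
  rw [e1, e2, e3, e4]
  ring

end Plaquette

/-! ## §3 The row `hRK`, M-booked -/

section Booked

variable {P : Params} {N : ℕ} [NeZero N] {i : ℕ}

/-- ★ **THE BOND MASS OF THE CHART REMAINDER**: if `i·R_b = Φ♯(u(b.src), Y_b + 1, δ_b)` on every bond, under the sup rows `‖u − 1‖ ≤ σ`, `‖Y_b‖ ≤ τ`,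
`‖δ_b‖ ≤ ρ` (`≤ 1∕256`): `Σ_b‖R_b‖² ≤ 2(4σ + 8ρ)²·Σ_b‖Y_b‖² + 72σ²·Σ_b‖δ_b‖²`. [cite: Balaban1985Variational, (141)-(143) p.299] -/
theorem sum_norm_sq_chartRemainder_le (u : Site P i → Matrix.specialUnitaryGroup (Fin N) ℂ) (Y δ R : PBond P i → Matrix (Fin N) (Fin N) ℂ) {σ τ ρ : ℝ}
    (hσ : σ ≤ 1 / 256) (hτ : τ ≤ 1 / 256) (hρ : ρ ≤ 1 / 256)
    (hu : ∀ x, ‖(u x : Matrix (Fin N) (Fin N) ℂ) - 1‖ ≤ σ) (hY : ∀ b, ‖Y b‖ ≤ τ) (hδ : ∀ b, ‖δ b‖ ≤ ρ)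
    (hR : ∀ b : PBond P i, Complex.I • R b
        = mlog ((u b.src : Matrix (Fin N) (Fin N) ℂ) * (Y b + 1) * exp (-mlog (u b.src : Matrix (Fin N) (Fin N) ℂ) + δ b)) - (mlog (Y b + 1) + δ b)) :
    ∑ b : PBond P i, ‖R b‖ ^ 2 ≤ 2 * (4 * σ + 8 * ρ) ^ 2 * ∑ b : PBond P i, ‖Y b‖ ^ 2 + 72 * σ ^ 2 * ∑ b : PBond P i, ‖δ b‖ ^ 2 := by
  rw [Finset.mul_sum, Finset.mul_sum, ← Finset.sum_add_distrib]
  refine Finset.sum_le_sum fun b _ => ?_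
  have hI : ‖R b‖ = ‖Complex.I • R b‖ := by rw [norm_smul, Complex.norm_I, one_mul]
  have h := norm_chartRemainderDiag_le_bilinear (u b.src) (Y b + 1) (δ b) hσ hτ hρ (hu _) (by rw [add_sub_cancel_right]; exact hY b) (hδ b)
  rw [← hR b, ← hI, add_sub_cancel_right] at h
  have h0 : 0 ≤ ‖R b‖ := norm_nonneg _
  have hsq := pow_le_pow_left₀ h0 h 2
  nlinarith [sq_nonneg ((4 * σ + 8 * ρ) * ‖Y b‖ - 6 * σ * ‖δ b‖)]

/-- ★★★ **THE ROW `hRK` OF THE (α′) KNIT, M-BOOKED** (namer note (a)): for any background `W`, if `i·R_b = Φ♯(u(b.src), Y_b + 1, δ_b)` on every bond,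
under the sup rows (`σ, τ, ρ ≤ 1∕256`):
`K_W(i·R) ≤ 16d·(2(4σ + 8ρ)²·Σ_b‖Y_b‖² + 72σ²·Σ_b‖δ_b‖²)` — `θ₃ ∝ (σ + ρ)²` times the bond masses of `Y` and `δ = −D_W log u`, no volume factor.
[cite: Balaban1985Variational, (47)-(48) pp.285-286, (141)-(143) p.299] -/
theorem plaqK_le_of_bilinear (W : GaugeField P i (Matrix.specialUnitaryGroup (Fin N) ℂ))
    (u : Site P i → Matrix.specialUnitaryGroup (Fin N) ℂ) (Y δ R : PBond P i → Matrix (Fin N) (Fin N) ℂ) {σ τ ρ : ℝ}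
    (hσ : σ ≤ 1 / 256) (hτ : τ ≤ 1 / 256) (hρ : ρ ≤ 1 / 256)
    (hu : ∀ x, ‖(u x : Matrix (Fin N) (Fin N) ℂ) - 1‖ ≤ σ) (hY : ∀ b, ‖Y b‖ ≤ τ) (hδ : ∀ b, ‖δ b‖ ≤ ρ)
    (hR : ∀ b : PBond P i, Complex.I • R b
        = mlog ((u b.src : Matrix (Fin N) (Fin N) ℂ) * (Y b + 1) * exp (-mlog (u b.src : Matrix (Fin N) (Fin N) ℂ) + δ b)) - (mlog (Y b + 1) + δ b)) :
    (∑ p : Plaq P i, ‖((Complex.I • R ⟨p.src, p.μ⟩)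
          + ((W ⟨p.src, p.μ⟩ : Matrix (Fin N) (Fin N) ℂ) * (Complex.I • R ⟨p.src.shift p.μ, p.ν⟩) * star (W ⟨p.src, p.μ⟩ : Matrix (Fin N) (Fin N) ℂ))
          - (((W ⟨p.src, p.μ⟩ * W ⟨p.src.shift p.μ, p.ν⟩ * (W ⟨p.src.shift p.ν, p.μ⟩)⁻¹ : Matrix.specialUnitaryGroup (Fin N) ℂ) : Matrix (Fin N) (Fin N) ℂ)
              * (Complex.I • R ⟨p.src.shift p.ν, p.μ⟩)
              * star ((W ⟨p.src, p.μ⟩ * W ⟨p.src.shift p.μ, p.ν⟩ * (W ⟨p.src.shift p.ν, p.μ⟩)⁻¹ : Matrix.specialUnitaryGroup (Fin N) ℂ) : Matrix (Fin N) (Fin N) ℂ))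
          - (((GaugeField.plaqHol W p : Matrix.specialUnitaryGroup (Fin N) ℂ) : Matrix (Fin N) (Fin N) ℂ) * (Complex.I • R ⟨p.src, p.ν⟩)
              * star ((GaugeField.plaqHol W p : Matrix.specialUnitaryGroup (Fin N) ℂ) : Matrix (Fin N) (Fin N) ℂ)))‖ ^ 2)
      ≤ 16 * P.d * (2 * (4 * σ + 8 * ρ) ^ 2 * ∑ b : PBond P i, ‖Y b‖ ^ 2 + 72 * σ ^ 2 * ∑ b : PBond P i, ‖δ b‖ ^ 2) := by
  have h1 := plaqK_le_sum_bond W R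
  have h2 := sum_norm_sq_chartRemainder_le u Y δ R hσ hτ hρ hu hY hδ hR
  have hd : (0 : ℝ) ≤ 16 * P.d := by positivity
  exact h1.trans (mul_le_mul_of_nonneg_left h2 hd)

end Booked

end Summit.QuantumFields.YangMills.Theorems.Prop7PinnedRegaugeChartDivergenceHRK

end
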